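import Summits.BirchSwinnertonDyer.BirchSwinnertonDyer.Theorems.AdditiveKolyvaginRoadKolyvaginPerfLocal
import Summits.BirchSwinnertonDyer.BirchSwinnertonDyer.Theorems.AdditiveKolyvaginRoadKolyvaginPerfCore
import Summits.BirchSwinnertonDyer.BirchSwinnertonDyer.Theorems.AdditiveKolyvaginRoadKolyvaginGrossBridge
import Summits.BirchSwinnertonDyer.BirchSwinnertonDyer.Theorems.KolyvaginRoadThreeMethod2KolyvaginIsoBoundCore
import HarnessLib

/-!
# Route `AdditiveKolyvaginRoad`, crux `KolyvaginPrimitiveAdditive` (item stmt-BirchSwinnertonDyer-20132):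
# stub LOC, towards (Supply) at a general odd prime `p` — the LOCAL (Perf) CORE in cocycle currency and PROPORTIONALITY OF
# TRANSVERSE-TYPE COCYCLES at a Kolyvagin prime (first layer of the port of zhang3-p1's (IsoBound))
# (cell `pub/bsd-wall`, lead prover `bsd-wall-akr-p1` g3; `--supports stmt-BirchSwinnertonDyer-20132`, helper;
# p-generic port of zhang3-p1's `Theorems/KolyvaginRoadThreeMethod2KolyvaginIsoBoundCore.lean`, `3 ↦ p¹`)

WHY THIS FILE. Stub LOC of skeleton v8 of crux 20132 is reduced to (Supply) alone (p540947). At `p = 3` (Supply) follows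
(koly3b `ZhangSupply.hSupply_of_poitouTate`) from the named Poitou–Tate fact and ONE local input, (IsoBound): at a
Kolyvagin prime, two eigenclasses of the same sign whose localisations are mutually and self isotropic have proportional
localisations (zhang3-p1 g10 `…Method2KolyvaginIsoBound{Core,Local,}`). This file ports the first of its three layers to a
general odd prime: the local (Perf) core for LOCAL cocycles (the cup product of an unramified rank-one cocycle with a
ramified partner is non-zero) and the proportionality of two transverse-type cocycles.

WHAT. `twoCocycleClass_weilCupCocycle_ne_zero_P`, `exists_eq_zsmul_of_apply_frob_eq_zero_P` — zhang3-p1's proofs with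
`3 ↦ p¹` over this seat's `…PerfLocal` ∕ `…PerfCore` ∕ `…GrossBridge` and bsd-jet's decomposition-trivial lemmas.

HONEST FRAMING: theorems only; 0 definitions, 0 named facts, 0 `sorry`; closes nothing.

References: [cite: WZhang2014, Lemma 8.4 (1), (3)] [cite: MilneADT2006, Ch. I, Cor. 2.3] [cite: MazurRubin2004, Prop. 1.3.2]
[cite: NeukirchANT1999, I §9 Prop. (9.4)] [cite: SerreLocalFields1979, IV §2].
-/

-- single-conjunct summit: `Summit.BirchSwinnertonDyer.BirchSwinnertonDyer.…` repeats the name by design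
set_option linter.dupNamespace false

noncomputable section

open scoped Classical Pointwise

namespace Summit.BirchSwinnertonDyer.BirchSwinnertonDyer.Theorems.AdditiveKoly

open CategoryTheory WeierstrassCurve Field Function NumberField IsDedekindDomain
open Literature.NumberTheory.EllipticCurves Literature.NumberTheory.EllipticCurves.ModularForms
  Literature.NumberTheory.GaloisRepresentations Module
open Literature.NumberTheory.GaloisRepresentations.DiscreteGaloisModule (mu MuCarrier tateDual tateDualEval TateDual)
open Literature.NumberTheory.GaloisCohomology
open Summit.BirchSwinnertonDyer.Rank1Residual.X11b.Three.Koly.Method2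
open Summit.BirchSwinnertonDyer.Rank1Residual.GaloisImage
open Summit.BirchSwinnertonDyer.Rank1Residual.JET Summit.BirchSwinnertonDyer.Rank1Residual.X11b
open scoped ContRepresentation

variable (W : WeierstrassCurve ℚ) (K : Type) [Field K] [NumberField K] (p : ℕ) [W.IsElliptic] [W.IsGloballyMinimal]
  [Fact p.Prime] [∀ v : Place K, CompactSpace (absoluteGaloisGroup (Place.Completion v))]
  [Finite (geomTorsion (W.baseChange K) ((p ^ 1 : ℕ) : ℤ))]

set_option maxHeartbeats 800000 in
/-- **The local (Perf) core.** See the module docstring. [cite: WZhang2014, Lemma 8.4 (1), (3)]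
[cite: MilneADT2006, Ch. I, Cor. 2.3] [cite: MazurRubin2004, Prop. 1.3.2 (proof)] -/
theorem twoCocycleClass_weilCupCocycle_ne_zero_P (hK : IsImaginaryQuadratic K) (hp2 : p ≠ 2) (hsurj : W.HasSurjectiveModNGaloisRep p)
    (e : geomTorsion (W.baseChange K) ((p ^ 1 : ℕ) : ℤ) → geomTorsion (W.baseChange K) ((p ^ 1 : ℕ) : ℤ) →
      AlgebraicClosure K)
    (hμ : ∀ P Q, e P Q ^ (p ^ 1) = 1) (hadd₁ : ∀ P₁ P₂ Q, e (P₁ + P₂) Q = e P₁ Q * e P₂ Q)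
    (hadd₂ : ∀ P Q₁ Q₂, e P (Q₁ + Q₂) = e P Q₁ * e P Q₂) (hnondeg : ∀ Q, (∀ P, e P Q = 1) → Q = 0)
    (hgal : ∀ (σ : absoluteGaloisGroup K) (P Q : geomTorsion (W.baseChange K) ((p ^ 1 : ℕ) : ℤ)),
      σ • e P Q = e (σ • P) (σ • Q))
    {ℓ : ℕ} (hℓ : Zhang2014.IsKolyvaginPrime (W.conductorNorm ℤ) W K p ℓ) (v : HeightOneSpectrum (𝓞 K))
    (hv : (ℓ : 𝓞 K) ∈ v.asIdeal) {𝔐 : Ideal (HeightOneSpectrum.localAbsIntegers v)} (h𝔐 : 𝔐 ∈ v.localPrimesAbove)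
    {F : absoluteGaloisGroup K} (hF : IsArithFrobAt (𝓞 K) F (v.primeBelow (closureEmb (K := K) (v.adicCompletion K)) 𝔐))
    {gF : absoluteGaloisGroup (v.adicCompletion K)} (hgF : absGaloisRestrict K (v.adicCompletion K) gF = F)
    (fx fy : contOneCocycles (DiscreteGaloisModule.toLocal ((W.baseChange K).torsionGaloisModule ((p ^ 1 : ℕ) : ℤ)) (Sum.inr v)).toTopRep)
    (hxI : ∀ g, absGaloisRestrict K (v.adicCompletion K) g ∈
      (v.primeBelow (closureEmb (K := K) (v.adicCompletion K)) 𝔐).inertia (absoluteGaloisGroup K) → fx.1 g = 0)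
    (hP0 : fx.1 gF ≠ 0)
    (hram : ∃ g, absGaloisRestrict K (v.adicCompletion K) g ∈
      (v.primeBelow (closureEmb (K := K) (v.adicCompletion K)) 𝔐).inertia (absoluteGaloisGroup K) ∧
      weilPairingHom (W.baseChange K) (p ^ 1) e hμ hadd₁ hadd₂ (fx.1 gF) (fy.1 g) ≠ 0) :
    twoCocycleClass _ ((weilContPairingLocal (W.baseChange K) (p ^ 1) e hμ hadd₁ hadd₂ hgal (Sum.inr v)).cupCocycle fx fy)
      ≠ 0 := by
  classical
  have hp : p.Prime := Fact.out
  have hk1 : 1 ≤ Zhang2014.kolyvaginIndex W p ℓ := hℓ.2.2.2.2.2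
  haveI : NeZero (p ^ 1 : ℕ) := ⟨pow_ne_zero 1 hp.ne_zero⟩
  haveI : IsTotallyComplex K := hK.2
  -- the perfect Poitou–Tate family of the tree (local Tate duality at `λ`)
  obtain ⟨inv, hinvperf, -⟩ := poitouTate_sum_localTatePairing_eq_zero_of_isTotallyComplex K (p ^ 1)
  -- ### the Kolyvagin prime in Gross's sense; `v = λ`; `3 ∉ λ`
  have hℓG := isKolyvaginPrime_pow_one_of_zhang W K p hK hp2 hsurj hℓ
  have hvw : v = hℓG.place := hℓG.mem_iff.mp hv
  subst hvw
  obtain ⟨hgood, h3v⟩ := GlobalDuality.hasGoodReductionAt_of_zhangKolyvaginPrime W K hℓ hℓG.place hv 1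
  have h𝔓 : hℓG.place.primeBelow (closureEmb (K := K) (hℓG.place.adicCompletion K)) 𝔐 ∈ hℓG.place.primesAbove :=
    HeightOneSpectrum.primeBelow_mem_primesAbove h𝔐
  haveI := h𝔓.1
  have hD : ∀ d ∈ (hℓG.place.primeBelow (closureEmb (K := K) (hℓG.place.adicCompletion K)) 𝔐).decompositionSubgroup (absoluteGaloisGroup K),
      d ∈ torsionFixing (W.baseChange K) ((p ^ 1 : ℕ) : ℤ) := fun d hd ↦
    GlobalDuality.decompositionSubgroup_le_torsionFixing W K hK hℓ hk1 hℓG.place hv h𝔓 hd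
  have hres : ∀ g : absoluteGaloisGroup (hℓG.place.adicCompletion K), absGaloisRestrict K (hℓG.place.adicCompletion K) g ∈
      (hℓG.place.primeBelow (closureEmb (K := K) (hℓG.place.adicCompletion K)) 𝔐).decompositionSubgroup (absoluteGaloisGroup K) := fun g ↦ by
    rw [← resGal_eq_absGaloisRestrict, resGal_eq]; exact resGalOfEmb_mem_decompositionSubgroup _ h𝔐 g
  have hfixA : ∀ (g : absoluteGaloisGroup (hℓG.place.adicCompletion K)) (Q : geomTorsion (W.baseChange K) ((p ^ 1 : ℕ) : ℤ)),
      absGaloisRestrict K (hℓG.place.adicCompletion K) g • Q = Q := fun g Q ↦ smul_eq_of_mem_torsionFixing (W.baseChange K) _ (hD _ (hres g)) Q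
  have hfixμ : ∀ (g : absoluteGaloisGroup (hℓG.place.adicCompletion K)) (z : MuCarrier K (p ^ 1)), mu K (p ^ 1) (absGaloisRestrict K (hℓG.place.adicCompletion K) g) z = z := by
    intro g z
    apply MuCarrier.toAdditive.injective
    rw [DiscreteGaloisModule.mu_apply_apply]
    apply Additive.toMul.injective
    rw [toMul_ofMul]
    apply Subtype.ext
    apply Units.ext
    rw [absoluteGaloisGroup.coe_smul_rootsOfUnity, Units.coe_smul]
    have hz : ((((MuCarrier.toAdditive z).toMul : rootsOfUnity (p ^ 1) (AlgebraicClosure K)) : (AlgebraicClosure K)ˣ) :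
        AlgebraicClosure K) ^ p = 1 := by
      have h1 := ((MuCarrier.toAdditive z).toMul).2
      rw [mem_rootsOfUnity] at h1
      have h1' : ((MuCarrier.toAdditive z).toMul : rootsOfUnity (p ^ 1) (AlgebraicClosure K)).1 ^ p = 1 :=
        (congrArg (fun k : ℕ ↦ ((MuCarrier.toAdditive z).toMul : rootsOfUnity (p ^ 1) (AlgebraicClosure K)).1 ^ k)
          (pow_one p)).symm.trans h1
      rw [← Units.val_pow_eq_pow_val, h1', Units.val_one]
    exact smul_eq_self_of_pow_eq_one_of_mem_torsionFixing_P W K p e hμ hnondeg hgal (hD _ (hres g)) hz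
  have hpT : ∀ Q : geomTorsion (W.baseChange K) ((p ^ 1 : ℕ) : ℤ), p • Q = 0 := fun Q ↦ by
    have := (mem_geomTorsion_iff (W.baseChange K) ((p ^ 1 : ℕ) : ℤ) _).mp Q.2
    apply Subtype.ext
    rw [AddSubgroupClass.coe_nsmul, ← natCast_zsmul]
    simpa using this
  have hμ3 : ∀ z : MuCarrier K (p ^ 1), p • z = 0 := fun z ↦ by
    rw [← show (p ^ 1) • z = p • z from congrArg (fun k : ℕ ↦ k • z) (pow_one p), ← natCast_zsmul]
    exact zsmul_muCarrier_eq_zero K (p ^ 1) z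
  have hP3 : addOrderOf (fx.1 gF) = p := addOrderOf_eq_prime (hpT _) hP0
  have hfx_add : ∀ g g', fx.1 (g * g') = fx.1 g + fx.1 g' := fun g g' ↦
    (fx.2 g g').trans (congrArg (fun Q ↦ fx.1 g + Q) (hfixA g (fx.1 g')))
  have hfy_add : ∀ g g', fy.1 (g * g') = fy.1 g + fy.1 g' := fun g g' ↦
    (fy.2 g g').trans (congrArg (fun Q ↦ fy.1 g + Q) (hfixA g (fy.1 g')))
  have hfx1 : fx.1 1 = 0 := by
    have h := hfx_add 1 1
    rw [mul_one] at h
    exact left_eq_add.mp h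
  have hfy1 : fy.1 1 = 0 := by
    have h := hfy_add 1 1
    rw [mul_one] at h
    exact left_eq_add.mp h
  -- rank one of `fx`: `fx g = k • (fx.1 gF)`
  have hrank : ∀ g, ∃ k : ℕ, fx.1 g = k • (fx.1 gF) := by
    intro g
    exact KolyLocal.exists_apply_eq_nsmul_apply_of_unramified K hℓG.place h𝔐 fx.1 hfx_add hxI hF hgF g
  obtain ⟨W₀, hW₀⟩ : ∃ W₀, W₀ = weilPairingHom (W.baseChange K) (p ^ 1) e hμ hadd₁ hadd₂ := ⟨_, rfl⟩
  -- ### local Tate duality: a class `η'` of `H¹(K_λ, E[p]^D)` pairing non-trivially with `loc x`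
  have hM : ∀ m : geomTorsion (W.baseChange K) ((p ^ 1 : ℕ) : ℤ), (p ^ 1) • m = 0 := fun m ↦ AddSubgroup.torsionBy.nsmul m
  have hinjL := ((hinvperf hℓG.place).2 ((W.baseChange K).torsionGaloisModule ((p ^ 1 : ℕ) : ℤ)) hM).1.1
  have hξ0 : oneCocycleClass _ fx ≠ 0 := by
    intro h0
    obtain ⟨a, ha⟩ := (oneCocycleClass_eq_zero_iff _ fx).mp h0
    apply hP0
    rw [ha gF]
    exact sub_eq_zero.mpr (hfixA gF a)
  obtain ⟨η', hη'⟩ : ∃ η', DiscreteGaloisModule.localTatePairingZMod ((W.baseChange K).torsionGaloisModule ((p ^ 1 : ℕ) : ℤ)) (p ^ 1) (Sum.inr hℓG.place)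
      (inv (Sum.inr hℓG.place)) (oneCocycleClass _ fx) η' ≠ 0 := by
    by_contra hall
    push Not at hall
    exact hξ0 (hinjL ((AddMonoidHom.ext hall).trans (map_zero _).symm))
  obtain ⟨g', rfl⟩ := oneCocycleClass_surjective _ η'
  rw [DiscreteGaloisModule.localTatePairingZMod_apply, DiscreteGaloisModule.localTatePairing_oneCocycleClass,
    ContPairing.cupClass_eq_twoCocycleClass] at hη'
  -- ### the characters `n, m : Γ_λ → μ_p`
  let n : C(absoluteGaloisGroup (hℓG.place.adicCompletion K), MuCarrier K (p ^ 1)) :=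
    ⟨fun τ ↦ W₀ (fx.1 gF) (fy.1 τ), continuous_of_discreteTopology.comp fy.1.continuous⟩
  let m : C(absoluteGaloisGroup (hℓG.place.adicCompletion K), MuCarrier K (p ^ 1)) :=
    ⟨fun τ ↦ tateDualEval K _ (p ^ 1) (fx.1 gF) (g'.1 τ), continuous_of_discreteTopology.comp g'.1.continuous⟩
  have hn : ∀ τ, n τ = W₀ (fx.1 gF) (fy.1 τ) := fun _ ↦ rfl
  have hm : ∀ τ, m τ = g'.1 τ (fx.1 gF) := fun _ ↦ rfl
  have hn_add : ∀ τ τ', n (τ * τ') = n τ + n τ' := fun τ τ' ↦ by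
    rw [hn, hn, hn]
    exact (congrArg (fun Q ↦ W₀ (fx.1 gF) Q) (hfy_add τ τ')).trans (map_add _ _ _)
  have hg'_fix : ∀ (τ : absoluteGaloisGroup (hℓG.place.adicCompletion K)) (f : TateDual K (geomTorsion (W.baseChange K) ((p ^ 1 : ℕ) : ℤ)) (p ^ 1))
      (Q : geomTorsion (W.baseChange K) ((p ^ 1 : ℕ) : ℤ)),
      (((W.baseChange K).torsionGaloisModule ((p ^ 1 : ℕ) : ℤ)).tateDual (p ^ 1)) (absGaloisRestrict K (hℓG.place.adicCompletion K) τ) f Q = f Q := fun τ f Q ↦ by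
    rw [DiscreteGaloisModule.tateDual_apply_apply_apply, hfixμ]
    congr 1
    change (absGaloisRestrict K (hℓG.place.adicCompletion K) τ)⁻¹ • Q = Q
    rw [← map_inv]
    exact hfixA τ⁻¹ Q
  have hm_add : ∀ τ τ', m (τ * τ') = m τ + m τ' := fun τ τ' ↦
    (congrArg (fun f ↦ tateDualEval K _ (p ^ 1) (fx.1 gF) f) (g'.2 τ τ')).trans
      ((map_add (tateDualEval K _ (p ^ 1) (fx.1 gF)) _ _).trans
        (congrArg (fun t ↦ m τ + t) (hg'_fix τ (g'.1 τ') (fx.1 gF))))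
  -- the cocycle values
  have hc : ∀ σ τ, ((weilContPairingLocal (W.baseChange K) (p ^ 1) e hμ hadd₁ hadd₂ hgal (Sum.inr hℓG.place)).cupCocycle fx
      fy).1 (σ, τ) = W₀ (fx.1 σ) (fy.1 τ) := fun σ τ ↦ by
    rw [ContPairing.cupCocycle_apply_eq_smul, weilContPairingLocal_toLin_apply, hW₀]
    exact congrArg (fun Q ↦ weilPairingHom (W.baseChange K) (p ^ 1) e hμ hadd₁ hadd₂ (fx.1 σ) Q) (hfixA σ (fy.1 τ))
  have hc' : ∀ σ τ, ((DiscreteGaloisModule.tateDualPairingLocal ((W.baseChange K).torsionGaloisModule ((p ^ 1 : ℕ) : ℤ))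
      (p ^ 1) (Sum.inr hℓG.place)).cupCocycle fx g').1 (σ, τ) = g'.1 τ (fx.1 σ) := fun σ τ ↦ by
    rw [ContPairing.cupCocycle_apply_eq_smul]
    exact hg'_fix σ (g'.1 τ) (fx.1 σ)
  -- ### the character identity and the rank-one conclusion
  have h3v' : ((p ^ 1 : ℕ) : 𝓞 K) ∉ hℓG.place.asIdeal := by
    have := h3v; rwa [Int.cast_natCast] at this
  obtain ⟨j, w₀, hkey⟩ := exists_sub_zsmul_eq_nsmul_P K hℓG.place p h𝔐 h3v' hℓG.valuation_natCast hF hgF fx.1 hfx_add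
    hxI hP3 n m hn_add hm_add
    (by obtain ⟨g₀, hg₀, hne⟩ := hram; exact ⟨g₀, hg₀, fun h0 ↦ hne (by rw [← h0, hn, hW₀])⟩)
  have hc'0 : twoCocycleClass _ ((DiscreteGaloisModule.tateDualPairingLocal
      ((W.baseChange K).torsionGaloisModule ((p ^ 1 : ℕ) : ℤ)) (p ^ 1) (Sum.inr hℓG.place)).cupCocycle fx g') ≠ 0 :=
    fun h0 ↦ hη' (by rw [h0]; exact map_zero _)
  letI : Module (ZMod p) (geomTorsion (W.baseChange K) ((p ^ 1 : ℕ) : ℤ)) := AddCommGroup.zmodModule hpT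
  refine twoCocycleClass_ne_zero_of_rank_one_P ((DiscreteGaloisModule.toLocal (mu K (p ^ 1)) (Sum.inr hℓG.place)).toTopRep)
    fx.1 hfx_add hP3 hrank n m
    ((weilContPairingLocal (W.baseChange K) (p ^ 1) e hμ hadd₁ hadd₂ hgal (Sum.inr hℓG.place)).cupCocycle fx fy)
    ((DiscreteGaloisModule.tateDualPairingLocal ((W.baseChange K).torsionGaloisModule ((p ^ 1 : ℕ) : ℤ)) (p ^ 1)
      (Sum.inr hℓG.place)).cupCocycle fx g')
    (fun σ τ k hk ↦ ?_) (fun σ τ k hk ↦ ?_) hμ3 (fun g ↦ hfixμ g w₀)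
    hkey hp2 hc'0
  · -- `c(σ, τ) = k_σ · n(τ)`
    rw [hc]
    exact (congrArg (fun Q ↦ W₀ Q (fy.1 τ)) hk).trans (map_nsmul (W₀.flip (fy.1 τ)) k (fx.1 gF))
  · -- `c'(σ, τ) = k_σ · m(τ)`
    rw [hc']
    exact (congrArg (fun Q ↦ g'.1 τ Q) hk).trans (map_nsmul (g'.1 τ) k (fx.1 gF))

omit [W.IsElliptic] [W.IsGloballyMinimal] [∀ v : Place K, CompactSpace (absoluteGaloisGroup (Place.Completion v))]
  [Finite (geomTorsion (W.baseChange K) ((p ^ 1 : ℕ) : ℤ))] in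
/-- **Two transverse-type cocycles are proportional.** At a finite place `v` of `K` (any number field) with a continuous
multiplicative section of `res : Γ_{K_v} ⥲ G_𝔓` available (`exists_continuous_lift_decompositionSubgroup`), let
`f, f' : Γ_{K_v} → M` be continuous additive maps into a finite discrete `p`-torsion group, both vanishing at a lift `g_F`
of an arithmetic Frobenius at `𝔓`, with `f` RAMIFIED and all inertia values of `f` and `f'` on ONE line `ℤ Q` with
`3 Q = 0`. Then `f' = a · f` for some `a ∈ ℤ`: the pair `(f, f')` restricted to `I_𝔓` takes values on a line
`ℕ · (X₁, Y₁)` (SIMULTANEOUS tame factorisation, `InertiaTame.exists_forall_apply_eq_nsmul`, `v ∤ 3`, uniformiser in `K`),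
`X₁ ≠ 0`, `Y₁ = a X₁` on the line `ℤ Q ≅ ℤ/3`, and `Γ_{K_v} = ⟨g_F⟩ · I · U`. [cite: NeukirchANT1999, I §9 Prop. (9.4)]
[cite: SerreLocalFields1979, IV §2] -/
theorem exists_eq_zsmul_of_apply_frob_eq_zero_P (v : HeightOneSpectrum (𝓞 K))
    {𝔐 : Ideal (HeightOneSpectrum.localAbsIntegers v)} (h𝔐 : 𝔐 ∈ v.localPrimesAbove)
    (h3v : ((p ^ 1 : ℕ) : 𝓞 K) ∉ v.asIdeal) {π₀ : K} (hπ₀ : v.valuation K π₀ = WithZero.exp (-1 : ℤ))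
    {F : absoluteGaloisGroup K} (hF : IsArithFrobAt (𝓞 K) F (v.primeBelow (closureEmb (K := K) (v.adicCompletion K)) 𝔐))
    {gF : absoluteGaloisGroup (v.adicCompletion K)} (hgF : absGaloisRestrict K (v.adicCompletion K) gF = F)
    {M : Type*} [AddCommGroup M] [TopologicalSpace M] [DiscreteTopology M] [Finite M] (hM3 : ∀ m : M, p • m = 0)
    (f f' : C(absoluteGaloisGroup (v.adicCompletion K), M)) (hf : ∀ g g', f (g * g') = f g + f g')
    (hf' : ∀ g g', f' (g * g') = f' g + f' g') (hfF : f gF = 0) (hf'F : f' gF = 0)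
    {Q : M} (hQ3 : addOrderOf Q = p)
    (hfI : ∀ g, absGaloisRestrict K (v.adicCompletion K) g ∈
      (v.primeBelow (closureEmb (K := K) (v.adicCompletion K)) 𝔐).inertia (absoluteGaloisGroup K) →
      f g ∈ AddSubgroup.zmultiples Q ∧ f' g ∈ AddSubgroup.zmultiples Q)
    (hram : ∃ g, absGaloisRestrict K (v.adicCompletion K) g ∈
      (v.primeBelow (closureEmb (K := K) (v.adicCompletion K)) 𝔐).inertia (absoluteGaloisGroup K) ∧ f g ≠ 0) :
    ∃ a : ℤ, ∀ g, f' g = a • f g := by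
  set Kv := v.adicCompletion K with hKv
  set D := (v.primeBelow (closureEmb (K := K) Kv) 𝔐).decompositionSubgroup (absoluteGaloisGroup K) with hDdef
  set I := (v.primeBelow (closureEmb (K := K) Kv) 𝔐).inertia (absoluteGaloisGroup K) with hIdef
  have h𝔓 : v.primeBelow (closureEmb (K := K) Kv) 𝔐 ∈ v.primesAbove := HeightOneSpectrum.primeBelow_mem_primesAbove h𝔐
  have hinj : Injective (absGaloisRestrict K Kv) := absGaloisRestrict_adicCompletion_injective K v
  have hres : ∀ g : absoluteGaloisGroup Kv, absGaloisRestrict K Kv g ∈ D := fun g ↦ by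
    rw [hDdef, ← resGal_eq_absGaloisRestrict, resGal_eq]; exact resGalOfEmb_mem_decompositionSubgroup _ h𝔐 g
  have hID : I ≤ D := Ideal.inertia_le_stabilizer _
  have h1 : ∀ (θ : C(absoluteGaloisGroup Kv, M)), (∀ τ τ', θ (τ * τ') = θ τ + θ τ') → θ 1 = 0 :=
    fun θ hθ ↦ by have h := hθ 1 1; rw [mul_one] at h; exact left_eq_add.mp h
  have hpow : ∀ (θ : C(absoluteGaloisGroup Kv, M)), (∀ τ τ', θ (τ * τ') = θ τ + θ τ') → θ gF = 0 →
      ∀ N : ℕ, θ (gF ^ N) = 0 := by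
    intro θ hθ h0 N
    induction N with
    | zero => rw [pow_zero, h1 θ hθ]
    | succ N ih => rw [pow_succ gF N, hθ, ih, h0, add_zero]
  -- ### the continuous lift and the pair `(f, f') ∘ L` on `I_𝔓`
  obtain ⟨L, hLc, hL, hLmul⟩ := KolyLocal.exists_continuous_lift_decompositionSubgroup K v h𝔐
  let a : I → M × M := fun i ↦ (f (L ⟨i, hID i.2⟩), f' (L ⟨i, hID i.2⟩))
  have ha : ∀ i, a i = (f (L ⟨i, hID i.2⟩), f' (L ⟨i, hID i.2⟩)) := fun _ ↦ rfl
  have hLi : Continuous fun i : I ↦ L ⟨i, hID i.2⟩ := hLc.comp (Continuous.subtype_mk continuous_subtype_val _)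
  have hac : Continuous a := (f.continuous.comp hLi).prodMk (f'.continuous.comp hLi)
  have haa : ∀ i i', a (i * i') = a i + a i' := fun i i' ↦ by
    rw [ha, ha, ha, Prod.mk_add_mk, ← hf, ← hf', ← hLmul]
    rfl
  have hT : ∀ t : M × M, (p ^ 1) • t = 0 := fun t ↦
    (congrArg (fun k : ℕ ↦ k • t) (pow_one p)).trans (Prod.ext (hM3 t.1) (hM3 t.2))
  have hp1pos : 0 < p ^ 1 := pow_pos (Fact.out : p.Prime).pos 1
  obtain ⟨z, hz⟩ := IsAlgClosed.exists_pow_nat_eq (algebraMap K (AlgebraicClosure K) π₀) hp1pos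
  obtain ⟨σ₁, -, hσ₁⟩ := InertiaTame.exists_forall_apply_eq_nsmul v hp1pos h3v hπ₀ hz h𝔓 hT a hac haa
  set X₁ := f (L ⟨σ₁, hID σ₁.2⟩) with hX₁def
  set Y₁ := f' (L ⟨σ₁, hID σ₁.2⟩) with hY₁def
  have ha₁ : a σ₁ = (X₁, Y₁) := ha σ₁
  -- `f` ramified ⟹ `X₁ ≠ 0`
  have hX₁ : X₁ ≠ 0 := by
    obtain ⟨g, hgI, hg0⟩ := hram
    intro h0
    apply hg0
    obtain ⟨kᵢ, hkᵢ⟩ := hσ₁ ⟨_, hgI⟩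
    have hg : L ⟨absGaloisRestrict K Kv g, hID hgI⟩ = g := hinj (hL _)
    have hfg : (a ⟨_, hgI⟩).1 = f g := by rw [ha]; change f (L ⟨absGaloisRestrict K Kv g, _⟩) = f g; rw [hg]
    rw [← hfg, hkᵢ, ha₁, Prod.smul_fst, h0, smul_zero]
  -- `X₁, Y₁ ∈ ℤ Q` with `Q` of order `p`, `X₁ ≠ 0`: `Y₁ = a X₁`
  have hσ₁I : absGaloisRestrict K Kv (L ⟨σ₁, hID σ₁.2⟩) ∈ I := by rw [hL]; exact σ₁.2
  obtain ⟨hX₁Q, hY₁Q⟩ := hfI _ hσ₁I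
  obtain ⟨a₀, ha₀⟩ : ∃ a₀ : ℤ, a₀ • X₁ = Y₁ := by
    have hX₁3 : addOrderOf X₁ = p := addOrderOf_eq_prime (hM3 _) hX₁
    have hle : AddSubgroup.zmultiples X₁ ≤ AddSubgroup.zmultiples Q := AddSubgroup.zmultiples_le.mpr hX₁Q
    have heq : AddSubgroup.zmultiples X₁ = AddSubgroup.zmultiples Q :=
      AddSubgroup.eq_of_le_of_card_ge hle (by rw [Nat.card_zmultiples, Nat.card_zmultiples, hQ3, hX₁3])
    have h := hY₁Q
    rw [← heq] at h
    exact AddSubgroup.mem_zmultiples_iff.mp h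
  refine ⟨a₀, fun τ ↦ ?_⟩
  -- ### decompose `τ = g_F ^ k · g_i · g_u`
  have hO : IsOpen (f ⁻¹' {0} ∩ f' ⁻¹' {0}) :=
    ((isOpen_discrete ({0} : Set M)).preimage f.continuous).inter ((isOpen_discrete ({0} : Set M)).preimage f'.continuous)
  have h1O : (1 : absoluteGaloisGroup Kv) ∈ f ⁻¹' {0} ∩ f' ⁻¹' {0} := ⟨h1 f hf, h1 f' hf'⟩
  obtain ⟨U, hU, hUO⟩ := KolyLocal.exists_isOpen_subgroup_absGaloisRestrict_mem K v hO h1O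
  obtain ⟨k', i', u, hi', hu, hdec⟩ := exists_eq_frobenius_pow_mul_of_mem_decompositionSubgroup h𝔓 hF hU (hres τ)
  set gi := L ⟨i', hID hi'⟩ with hgidef
  have hgi : absGaloisRestrict K Kv gi = i' := hL _
  set gu := (gF ^ k' * gi)⁻¹ * τ with hgudef
  have hgu : absGaloisRestrict K Kv gu = u := by
    rw [hgudef, map_mul, map_inv, map_mul, map_pow, hgF, hgi, hdec, inv_mul_cancel_left]
  have hτ : τ = gF ^ k' * gi * gu := by rw [hgudef, mul_inv_cancel_left]
  obtain ⟨hfu, hf'u⟩ := hUO gu (hgu ▸ hu)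
  obtain ⟨kᵢ, hkᵢ⟩ := hσ₁ ⟨i', hi'⟩
  rw [ha, ha₁] at hkᵢ
  have hfgi : f gi = kᵢ • X₁ := by have := congrArg Prod.fst hkᵢ; rwa [Prod.smul_fst] at this
  have hf'gi : f' gi = kᵢ • Y₁ := by have := congrArg Prod.snd hkᵢ; rwa [Prod.smul_snd] at this
  have hfτ : f τ = kᵢ • X₁ := by rw [hτ, hf, hf, hpow f hf hfF, hfgi, hfu, zero_add, add_zero]
  have hf'τ : f' τ = kᵢ • Y₁ := by rw [hτ, hf', hf', hpow f' hf' hf'F, hf'gi, hf'u, zero_add, add_zero]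
  rw [hfτ, hf'τ, ← ha₀, smul_comm]


end Summit.BirchSwinnertonDyer.BirchSwinnertonDyer.Theorems.AdditiveKoly

end
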